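import Summits.ABC.ABC.Theorems.CongruentialReceptacleTameLocalReceptacleEngineCellsDefs
import Summits.ABC.ABC.Theorems.CongruentialReceptacleTameLocalReceptacleTailCellsFamilies
import Summits.ABC.ABC.Theorems.CongruentialReceptacleTameLocalReceptacleStubTiltBound
import Summits.ABC.ABC.Theorems.CongruentialReceptacleTameLocalReceptacleStubKeyCellsOfCellLaws
import Literature.NumberTheory.Sieve.SmoothTernaryCrudeCountRegimes
import Literature.NumberTheory.Sieve.SmoothValuationTailSum

/-!
# Crux `TameLocalReceptacle` (stmt-ABC-14354), line `grh-friable-cell-resolution`: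
# the non-shallow cells carry small mass (`stub_tailCells`)

Registered stub `stub_tailCells : FamilySize → TailCells` of the checked skeleton
`Cruxes/TameLocalReceptacle/Lines/grh_friable_cell_resolution.lean` (lead `prover-line-stmt-ABC-14354-a1-0`,
wave 6 "tails").  With `x = masterScale N M = 48 · 2^N M` (a natural number), `y = levelOf N M = ⌊(log x)^{100000}⌋`,
`Y = shallowOf N M = y⁴` and each of the five families `F`:
* (CRUDE CELL BOUND, `TailCellsBook.crude_cells_FA/FC`) for an odd prime `q` and `v ≥ 1`,
  `#F · cellMass F P q v` is a number of parameter pairs with `q^v ∥ member_P` (`…FamilyCounts`), which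
  `…TailCellsFamilies` injects into the `y`-friable solutions of a ternary equation in boxes with one box shrunken
  by `q^v`; the tree's `ternary_crude_count_two_regimes` (Harper's restriction bound + Hölder at the scales
  `z ∈ [√x, x]`, trivial bound below `√x`) bounds those by `C ((log x)^{24} (q^v)^{-7/12} + x^{-2/5}) Ψ(x,y)³/x`, and by
  `0` once `q^v > x`; dividing by `#F ≥ c Ψ(x,y)³/x` (`FamilySize`) gives
  `cellMass F P q v ≤ A ((log x)^{24} (q^v)^{-7/12} + x^{-2/5})`;
* (FRIABILITY) cells at primes `q > y` are empty (`CellLawsBook.cellMass_eq_zero_of_lt`);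
* (SUMMATION) the tree's `valuation_tail_sum_small`: over the non-shallow cells `q^{v+1} > y⁴` these bounds, weighted by
  `keyWeight = (v+1) log q`, sum to `≤ e` for `M` large.
-/

-- `Summit.<Summit>.<Problem>` is the mandated summit-side namespace (CONVENTIONS §2); for the
-- single-conjunct summit `ABC` the two coincide, so the duplicate `ABC.ABC` is deliberate.
set_option linter.dupNamespace false

noncomputable section

namespace Summit.ABC.ABC.Theorems.TameLocalReceptacle

open Finset Filter Literature.NumberTheory.Sieve

namespace TailCellsBook

/-! ### The master scale as a natural number -/

/-- `x = 48 · (2^N M)` is (the cast of) a natural number. [folklore] -/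
theorem masterScale_eq_natCast (N M : ℕ) : masterScale N M = ((48 * (2 ^ N * M) : ℕ) : ℝ) := by
  unfold masterScale; push_cast; ring

/-- `y = ⌊(log x)^{100000}⌋` with the natural `x`. [folklore] -/
theorem levelOf_eq (N M : ℕ) : levelOf N M = ⌊Real.log ((48 * (2 ^ N * M) : ℕ) : ℝ) ^ 100000⌋₊ := by
  rw [levelOf, masterScale_eq_natCast]

/-- `48 · 2^N M → ∞` (as a real number) as `M → ∞`. [folklore] -/
theorem tendsto_masterScale_nat (N : ℕ) : Tendsto (fun M : ℕ => 48 * (2 ^ N * M)) atTop atTop :=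
  tendsto_atTop_mono (fun M => (Nat.le_mul_of_pos_left M (Nat.two_pow_pos N)).trans
    (Nat.le_mul_of_pos_left _ (by norm_num))) tendsto_id

/-- `48 · 2^N M → ∞` (as a real number) as `M → ∞`. [folklore] -/
theorem tendsto_masterScale_real (N : ℕ) : Tendsto (fun M : ℕ => (((48 * (2 ^ N * M) : ℕ)) : ℝ)) atTop atTop :=
  tendsto_natCast_atTop_atTop.comp (tendsto_masterScale_nat N)

/-! ### Small helpers -/

/-- `2^a q^b ∣ (2q)^{a+b}`. [folklore] -/
theorem two_pow_mul_pow_dvd (a b q : ℕ) : 2 ^ a * q ^ b ∣ (2 * q) ^ (a + b) := by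
  rw [mul_pow]
  exact Nat.mul_dvd_mul (pow_dvd_pow 2 (Nat.le_add_right a b)) (pow_dvd_pow q (Nat.le_add_left b a))

/-- `√x ≤ 2M` for `x = 48 · 2^N M` once `M ≥ 12 · 2^N`. [folklore] -/
theorem sqrt_le_two_mul {N M : ℕ} (hM : 12 * 2 ^ N ≤ M) :
    (((48 * (2 ^ N * M) : ℕ)) : ℝ) ^ (1 / 2 : ℝ) ≤ ((2 * M : ℕ) : ℝ) := by
  rw [← Real.sqrt_eq_rpow, Real.sqrt_le_left (by positivity)]
  have h : ((12 * 2 ^ N : ℕ) : ℝ) ≤ M := by exact_mod_cast hM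
  push_cast at h ⊢
  nlinarith [show (0 : ℝ) ≤ 2 ^ N by positivity, Nat.cast_nonneg (α := ℝ) M]

/-- Division by the family size: `#F · cm ≤ cnt ≤ C B Φ` and `#F ≥ c Φ > 0` give `cm ≤ (C/c) B`. [folklore] -/
theorem cellMass_le_of_count {F : Finset (ℕ × ℕ × ℕ)} {P : Pos} {q v cnt : ℕ} {c C B Φ : ℝ} (hc : 0 < c)
    (hΦ : 0 < Φ) (hF : c * Φ ≤ (F.card : ℝ)) (hle : (F.card : ℝ) * cellMass F P q v ≤ cnt)
    (hcnt : (cnt : ℝ) ≤ C * B * Φ) (hCB : 0 ≤ C * B) : cellMass F P q v ≤ C / c * B := by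
  have hF0 : 0 < (F.card : ℝ) := lt_of_lt_of_le (mul_pos hc hΦ) hF
  rw [← le_div_iff₀' hF0] at hle
  calc cellMass F P q v ≤ cnt / F.card := hle
    _ ≤ C * B * Φ / (c * Φ) := by
        calc (cnt : ℝ) / F.card ≤ C * B * Φ / F.card := div_le_div_of_nonneg_right hcnt hF0.le
          _ ≤ C * B * Φ / (c * Φ) := div_le_div_of_nonneg_left (by positivity) (mul_pos hc hΦ) hF
    _ = C / c * B := by field_simp

/-- An empty count gives an empty cell. [folklore] -/
theorem cellMass_eq_zero_of_count {F : Finset (ℕ × ℕ × ℕ)} {P : Pos} {q v cnt : ℕ} (hF0 : 0 < (F.card : ℝ))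
    (hle : (F.card : ℝ) * cellMass F P q v ≤ cnt) (hcnt : cnt = 0) : cellMass F P q v = 0 := by
  rw [hcnt, Nat.cast_zero] at hle
  have h := CellLawsBook.cellMass_nonneg F P q v
  nlinarith

end TailCellsBook

open TailCellsBook

/-! ### Crude cell bounds for the families `FA(N', M')` and `FC(N, M)` -/

/-- **Crude cell bound, families `FAfam N' M' y`** at the master data `(N, M)` (`M ≤ M'`, `2^{N'} M' ≤ 2^N M`, so
`FA`, `G`, `G'` are covered): if `#FA(N', M') ≥ c Ψ(x,y)³/x` then for every position, odd prime `q` and `v ≥ 1`,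
`cellMass ≤ A ((log x)^{24} (q^v)^{-7/12} + x^{-2/5})`, and `cellMass = 0` once `q^v > x`. [folklore] -/
theorem TailCellsBook.crude_cells_FA (N : ℕ) {c : ℝ} (hc : 0 < c) : ∃ A : ℝ, 0 < A ∧ ∀ᶠ M : ℕ in atTop,
    ∀ (N' M' : ℕ), M ≤ M' → 2 ^ N' * M' ≤ 2 ^ N * M →
    c * ((Nat.smoothNumbersUpTo (48 * (2 ^ N * M)) (⌊Real.log ((48 * (2 ^ N * M) : ℕ) : ℝ) ^ 100000⌋₊ + 1)).card : ℝ) ^ 3 /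
        ((48 * (2 ^ N * M) : ℕ) : ℝ) ≤ (FAfam N' M' ⌊Real.log ((48 * (2 ^ N * M) : ℕ) : ℝ) ^ 100000⌋₊).card →
    ∀ (P : Pos) (q v : ℕ), q.Prime → q ≠ 2 → 1 ≤ v →
      cellMass (FAfam N' M' ⌊Real.log ((48 * (2 ^ N * M) : ℕ) : ℝ) ^ 100000⌋₊) P q v ≤
          A * (Real.log ((48 * (2 ^ N * M) : ℕ) : ℝ) ^ 24 * (((q : ℝ) ^ v)⁻¹) ^ (7 / 12 : ℝ) +
            (((48 * (2 ^ N * M) : ℕ) : ℝ))⁻¹ ^ (2 / 5 : ℝ)) ∧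
        ((((48 * (2 ^ N * M) : ℕ)) : ℝ) < (q : ℝ) ^ v →
          cellMass (FAfam N' M' ⌊Real.log ((48 * (2 ^ N * M) : ℕ) : ℝ) ^ 100000⌋₊) P q v = 0) := by
  obtain ⟨C₂, hC₂, hTR⟩ := ternary_crude_count_two_regimes
  refine ⟨C₂ / c, div_pos hC₂ hc, ?_⟩
  filter_upwards [(tendsto_masterScale_nat N).eventually hTR, eventually_ge_atTop (12 * 2 ^ N),
    eventually_ge_atTop 1] with M hTRx hM12 hM1 N' M' hMM' hX' hsize P q v hq hq2 hv
  set x : ℕ := 48 * (2 ^ N * M) with hxdef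
  set y : ℕ := ⌊Real.log (x : ℝ) ^ 100000⌋₊ with hydef
  set Ψ : ℝ := ((Nat.smoothNumbersUpTo x (y + 1)).card : ℝ) with hΨdef
  set B : ℝ := Real.log (x : ℝ) ^ 24 * (((q : ℝ) ^ v)⁻¹) ^ (7 / 12 : ℝ) + ((x : ℝ))⁻¹ ^ (2 / 5 : ℝ) with hB
  have hx0 : (0 : ℝ) < x := by rw [hxdef]; positivity
  have hΨ1 : 1 ≤ Ψ := by
    rw [hΨdef]
    exact_mod_cast Finset.card_pos.2 ⟨1, Nat.mem_smoothNumbersUpTo.2 ⟨Nat.succ_le_of_lt (by rw [hxdef]; positivity),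
      Nat.mem_smoothNumbers.2 ⟨one_ne_zero, by simp⟩⟩⟩
  have hΦ : 0 < Ψ ^ 3 / x := by positivity
  have hB0 : 0 ≤ C₂ * B := by positivity
  have hsize' : c * (Ψ ^ 3 / x) ≤ ((FAfam N' M' y).card : ℝ) := by rw [← mul_div_assoc]; exact hsize
  have hF0 : 0 < ((FAfam N' M' y).card : ℝ) := lt_of_lt_of_le (mul_pos hc hΦ) hsize'
  -- boxes
  set X₀ : ℕ := 2 ^ N * M with hX₀
  set X₀' : ℕ := 2 ^ N' * M' with hX₀'
  have hq1 : 1 ≤ q ^ v := Nat.one_le_pow _ _ hq.pos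
  have h2N' : 1 ≤ 2 ^ N' := Nat.one_le_two_pow
  have hM'X : M' ≤ X₀' := by rw [hX₀']; exact Nat.le_mul_of_pos_left M' (by positivity)
  have h2M : ∀ {b : ℕ}, 2 * M ≤ b → ((x : ℝ)) ^ (1 / 2 : ℝ) ≤ (b : ℝ) := fun hb =>
    (sqrt_le_two_mul hM12).trans (by exact_mod_cast hb)
  have hdiv : ∀ b : ℕ, b / q ^ v ≤ b ∧ b / q ^ v * q ^ v ≤ b := fun b => ⟨Nat.div_le_self _ _, Nat.div_mul_le_self _ _⟩
  -- conclude from a count bound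
  have finish : ∀ {cnt : ℕ}, ((FAfam N' M' y).card : ℝ) * cellMass (FAfam N' M' y) P q v ≤ cnt →
      ((cnt : ℝ) ≤ C₂ * B * Ψ ^ 3 / x ∧ (x < q ^ v → cnt = 0)) →
      cellMass (FAfam N' M' y) P q v ≤ C₂ / c * B ∧ (((x : ℕ) : ℝ) < (q : ℝ) ^ v → cellMass (FAfam N' M' y) P q v = 0) :=
    fun h4 h3 => ⟨cellMass_le_of_count hc hΦ hsize' h4 (by rw [← mul_div_assoc]; exact h3.1) hB0,
      fun hlt => cellMass_eq_zero_of_count hF0 h4 (h3.2 (by exact_mod_cast hlt))⟩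
  cases P with
  | A =>
    refine finish (tailPairsA_A hq hq2 hv N' M' y) (hTRx q v hq hq2 (2 * M' / q ^ v) (2 * X₀') (4 * X₀')
      (2 ^ N' * q ^ v) 1 (N' + v) 1 (Or.inl rfl) (by rw [mul_one]; exact two_pow_mul_pow_dvd N' v q)
      (h2M (by omega)) (by have := (hdiv (2 * M')).1; omega) (by omega) (by omega)
      (Or.inl ⟨?_, h2M (by omega)⟩) ?_)
    · have := (hdiv (2 * M')).2; omega
    · have h1 : 2 ^ N' * q ^ v * (2 * M' / q ^ v) ≤ 2 * X₀' := by
        rw [mul_assoc]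
        calc 2 ^ N' * (q ^ v * (2 * M' / q ^ v)) ≤ 2 ^ N' * (2 * M') := Nat.mul_le_mul_left _ (Nat.mul_div_le _ _)
          _ = 2 * X₀' := by rw [hX₀']; ring
      omega
  | B =>
    refine finish (tailPairsA_B hq hv N' M' y) (hTRx q v hq hq2 (2 * X₀' / q ^ v) (2 * M') (4 * X₀')
      (q ^ v) (2 ^ N') (N' + v) 1 (Or.inl rfl) (by rw [mul_comm]; exact two_pow_mul_pow_dvd N' v q)
      (h2M (by omega)) (by have := (hdiv (2 * X₀')).1; omega) (by omega) (by omega)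
      (Or.inl ⟨?_, h2M (by omega)⟩) ?_)
    · have := (hdiv (2 * X₀')).2; omega
    · have h1 : q ^ v * (2 * X₀' / q ^ v) ≤ 2 * X₀' := Nat.mul_div_le _ _
      have h2 : 2 ^ N' * (2 * M') = 2 * X₀' := by rw [hX₀']; ring
      omega
  | C =>
    refine finish (tailPairsA_C hq hv N' M' y) (hTRx q v hq hq2 (4 * X₀' / q ^ v) (2 * M') (2 * X₀')
      (q ^ v) (2 ^ N') (N' + v) (-1) (Or.inr rfl) (by rw [mul_comm]; exact two_pow_mul_pow_dvd N' v q)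
      (h2M (by omega)) (by have := (hdiv (4 * X₀')).1; omega) (by omega) (by omega)
      (Or.inl ⟨?_, h2M (by omega)⟩) ?_)
    · have := (hdiv (4 * X₀')).2; omega
    · have h1 : q ^ v * (4 * X₀' / q ^ v) ≤ 4 * X₀' := Nat.mul_div_le _ _
      have h2 : 2 ^ N' * (2 * M') = 2 * X₀' := by rw [hX₀']; ring
      omega

/-- **Crude cell bound, family `FCfam N M y`**: if `#FC ≥ c Ψ(x,y)³/x` then for every position, odd prime `q` and
`v ≥ 1`, `cellMass ≤ A ((log x)^{24} (q^v)^{-7/12} + x^{-2/5})`, and `cellMass = 0` once `q^v > x`. [folklore] -/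
theorem TailCellsBook.crude_cells_FC (N : ℕ) {c : ℝ} (hc : 0 < c) : ∃ A : ℝ, 0 < A ∧ ∀ᶠ M : ℕ in atTop,
    c * ((Nat.smoothNumbersUpTo (48 * (2 ^ N * M)) (⌊Real.log ((48 * (2 ^ N * M) : ℕ) : ℝ) ^ 100000⌋₊ + 1)).card : ℝ) ^ 3 /
        ((48 * (2 ^ N * M) : ℕ) : ℝ) ≤ (FCfam N M ⌊Real.log ((48 * (2 ^ N * M) : ℕ) : ℝ) ^ 100000⌋₊).card →
    ∀ (P : Pos) (q v : ℕ), q.Prime → q ≠ 2 → 1 ≤ v →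
      cellMass (FCfam N M ⌊Real.log ((48 * (2 ^ N * M) : ℕ) : ℝ) ^ 100000⌋₊) P q v ≤
          A * (Real.log ((48 * (2 ^ N * M) : ℕ) : ℝ) ^ 24 * (((q : ℝ) ^ v)⁻¹) ^ (7 / 12 : ℝ) +
            (((48 * (2 ^ N * M) : ℕ) : ℝ))⁻¹ ^ (2 / 5 : ℝ)) ∧
        ((((48 * (2 ^ N * M) : ℕ)) : ℝ) < (q : ℝ) ^ v →
          cellMass (FCfam N M ⌊Real.log ((48 * (2 ^ N * M) : ℕ) : ℝ) ^ 100000⌋₊) P q v = 0) := by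
  obtain ⟨C₂, hC₂, hTR⟩ := ternary_crude_count_two_regimes
  refine ⟨C₂ / c, div_pos hC₂ hc, ?_⟩
  filter_upwards [(tendsto_masterScale_nat N).eventually hTR, eventually_ge_atTop (12 * 2 ^ N),
    eventually_ge_atTop 1] with M hTRx hM12 hM1 hsize P q v hq hq2 hv
  set x : ℕ := 48 * (2 ^ N * M) with hxdef
  set y : ℕ := ⌊Real.log (x : ℝ) ^ 100000⌋₊ with hydef
  set Ψ : ℝ := ((Nat.smoothNumbersUpTo x (y + 1)).card : ℝ) with hΨdef
  set B : ℝ := Real.log (x : ℝ) ^ 24 * (((q : ℝ) ^ v)⁻¹) ^ (7 / 12 : ℝ) + ((x : ℝ))⁻¹ ^ (2 / 5 : ℝ) with hB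
  have hx0 : (0 : ℝ) < x := by rw [hxdef]; positivity
  have hΨ1 : 1 ≤ Ψ := by
    rw [hΨdef]
    exact_mod_cast Finset.card_pos.2 ⟨1, Nat.mem_smoothNumbersUpTo.2 ⟨Nat.succ_le_of_lt (by rw [hxdef]; positivity),
      Nat.mem_smoothNumbers.2 ⟨one_ne_zero, by simp⟩⟩⟩
  have hΦ : 0 < Ψ ^ 3 / x := by positivity
  have hB0 : 0 ≤ C₂ * B := by positivity
  have hsize' : c * (Ψ ^ 3 / x) ≤ ((FCfam N M y).card : ℝ) := by rw [← mul_div_assoc]; exact hsize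
  have hF0 : 0 < ((FCfam N M y).card : ℝ) := lt_of_lt_of_le (mul_pos hc hΦ) hsize'
  set X₀ : ℕ := 2 ^ N * M with hX₀
  have hq1 : 1 ≤ q ^ v := Nat.one_le_pow _ _ hq.pos
  have h2N : 1 ≤ 2 ^ N := Nat.one_le_two_pow
  have hMX : M ≤ X₀ := by rw [hX₀]; exact Nat.le_mul_of_pos_left M (by positivity)
  have h2M : ∀ {b : ℕ}, 2 * M ≤ b → ((x : ℝ)) ^ (1 / 2 : ℝ) ≤ (b : ℝ) := fun hb =>
    (sqrt_le_two_mul hM12).trans (by exact_mod_cast hb)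
  have hdiv : ∀ b : ℕ, b / q ^ v ≤ b ∧ b / q ^ v * q ^ v ≤ b := fun b => ⟨Nat.div_le_self _ _, Nat.div_mul_le_self _ _⟩
  have finish : ∀ {cnt : ℕ}, ((FCfam N M y).card : ℝ) * cellMass (FCfam N M y) P q v ≤ cnt →
      ((cnt : ℝ) ≤ C₂ * B * Ψ ^ 3 / x ∧ (x < q ^ v → cnt = 0)) →
      cellMass (FCfam N M y) P q v ≤ C₂ / c * B ∧ (((x : ℕ) : ℝ) < (q : ℝ) ^ v → cellMass (FCfam N M y) P q v = 0) :=
    fun h4 h3 => ⟨cellMass_le_of_count hc hΦ hsize' h4 (by rw [← mul_div_assoc]; exact h3.1) hB0,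
      fun hlt => cellMass_eq_zero_of_count hF0 h4 (h3.2 (by exact_mod_cast hlt))⟩
  have h4M : 2 ^ N * (4 * M) = 4 * X₀ := by rw [hX₀]; ring
  cases P with
  | A =>
    refine finish (tailPairsC_A hq hv N M y) (hTRx q v hq hq2 (4 * M) (2 * X₀ / q ^ v) (4 * X₀)
      (2 ^ N) (q ^ v) (N + v) (-1) (Or.inr rfl) (two_pow_mul_pow_dvd N v q)
      (h2M (by omega)) (by omega) (by have := (hdiv (2 * X₀)).1; omega) (by omega)
      (Or.inr ⟨?_, h2M (by omega)⟩) ?_)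
    · have := (hdiv (2 * X₀)).2; omega
    · have h1 : q ^ v * (2 * X₀ / q ^ v) ≤ 2 * X₀ := Nat.mul_div_le _ _
      omega
  | B =>
    refine finish (tailPairsC_B hq hv N M y) (hTRx q v hq hq2 (4 * M) (4 * X₀ / q ^ v) (2 * X₀)
      (2 ^ N) (q ^ v) (N + v) (-1) (Or.inr rfl) (two_pow_mul_pow_dvd N v q)
      (h2M (by omega)) (by omega) (by have := (hdiv (4 * X₀)).1; omega) (by omega)
      (Or.inr ⟨?_, h2M (by omega)⟩) ?_)
    · have := (hdiv (4 * X₀)).2; omega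
    · have h1 : q ^ v * (4 * X₀ / q ^ v) ≤ 4 * X₀ := Nat.mul_div_le _ _
      omega
  | C =>
    refine finish (tailPairsC_C hq hq2 hv N M y) (hTRx q v hq hq2 (4 * M / q ^ v) (2 * X₀) (4 * X₀)
      (2 ^ N * q ^ v) 1 (N + v) (-1) (Or.inr rfl) (by rw [mul_one]; exact two_pow_mul_pow_dvd N v q)
      (h2M (by omega)) (by have := (hdiv (4 * M)).1; omega) (by omega) (by omega)
      (Or.inl ⟨?_, h2M (by omega)⟩) ?_)
    · have := (hdiv (4 * M)).2; omega
    · have h1 : 2 ^ N * q ^ v * (4 * M / q ^ v) ≤ 4 * X₀ := by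
        rw [mul_assoc]
        calc 2 ^ N * (q ^ v * (4 * M / q ^ v)) ≤ 2 ^ N * (4 * M) := Nat.mul_le_mul_left _ (Nat.mul_div_le _ _)
          _ = 4 * X₀ := h4M
      omega

/-! ### The registered stub -/

/-- **Registered stub `stub_tailCells`** (line `grh-friable-cell-resolution` of crux stmt-ABC-14354, skeleton v6/v7):
the non-shallow key cells (`q^{v+1} > y⁴`) of the five explicit families carry total window-weighted mass `≤ e` for
`M` large — crude Hölder–restriction upper bounds for the numerator pair counts at the scales `z ∈ [√x, x]`
(trivial bound below `√x`), Rankin at the master saddle point, division by the family size (`FamilySize`), and the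
summation `valuation_tail_sum_small` over `q ≤ y` (friability) and `v` with `q^v ≤ x`. [folklore] -/
theorem stub_tailCells : FamilySize → TailCells := by
  intro hFS N hN e he
  obtain ⟨c, hc, M₁, hsize⟩ := hFS N hN
  obtain ⟨A₁, hA₁, hFA⟩ := crude_cells_FA N hc
  obtain ⟨A₂, hA₂, hFC⟩ := crude_cells_FC N hc
  have hA : 0 < max A₁ A₂ := lt_max_of_lt_left hA₁
  have hsum := (tendsto_masterScale_real N).eventually (valuation_tail_sum_small hA he)
  have hbasic := (tendsto_masterScale_real N).eventually polylog_regime_basic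
  obtain ⟨M₀, hM₀⟩ := eventually_atTop.1 (hFA.and (hFC.and (hsum.and (hbasic.and (eventually_ge_atTop M₁)))))
  refine ⟨M₀, fun M hM => ?_⟩
  obtain ⟨hFA, hFC, hsum, hbasic, hMM₁⟩ := hM₀ M hM
  obtain ⟨-, -, hy2, -⟩ := hbasic
  have hsz := hsize M hMM₁
  simp only [masterScale_eq_natCast, levelOf_eq, Nat.floor_natCast] at hsz
  set x : ℕ := 48 * (2 ^ N * M) with hxdef
  set y : ℕ := ⌊Real.log (x : ℝ) ^ 100000⌋₊ with hydef
  have hyl : levelOf N M = y := by rw [hydef, hxdef, levelOf_eq]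
  have hN1 : 2 ^ 1 * (2 ^ (N - 1) * M) = 2 ^ N * M := by
    rw [← mul_assoc, ← pow_add, Nat.add_sub_cancel' hN]
  have hN2 : 2 ^ 1 * M ≤ 2 ^ N * M := Nat.mul_le_mul_right M (Nat.pow_le_pow_right two_pos hN)
  have hMle : M ≤ 2 ^ (N - 1) * M := Nat.le_mul_of_pos_left M (by positivity)
  -- the crude cell bounds for the five families, uniform constant `max A₁ A₂`
  have hcell : ∀ F : Finset (ℕ × ℕ × ℕ),
      (F = famFA N M ∨ F = famFB N M ∨ F = famFC N M ∨ F = famG N M ∨ F = famG' N M) →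
      ∀ (P : Pos) (q v : ℕ), q.Prime → q ≠ 2 → 1 ≤ v →
        (cellMass F P q v ≤ max A₁ A₂ * (Real.log (x : ℝ) ^ 24 * (((q : ℝ) ^ v)⁻¹) ^ (7 / 12 : ℝ) +
            ((x : ℝ))⁻¹ ^ (2 / 5 : ℝ))) ∧ (((x : ℕ) : ℝ) < (q : ℝ) ^ v → cellMass F P q v = 0) := by
    have hB0 : ∀ q v : ℕ, 0 ≤ Real.log (x : ℝ) ^ 24 * (((q : ℝ) ^ v)⁻¹) ^ (7 / 12 : ℝ) + ((x : ℝ))⁻¹ ^ (2 / 5 : ℝ) :=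
      fun q v => by positivity
    have mono₁ : ∀ {t B : ℝ}, 0 ≤ B → t ≤ A₁ * B → t ≤ max A₁ A₂ * B := fun hB h =>
      h.trans (mul_le_mul_of_nonneg_right (le_max_left _ _) hB)
    have mono₂ : ∀ {t B : ℝ}, 0 ≤ B → t ≤ A₂ * B → t ≤ max A₁ A₂ * B := fun hB h =>
      h.trans (mul_le_mul_of_nonneg_right (le_max_right _ _) hB)
    have hA' : ∀ (N' M' : ℕ), M ≤ M' → 2 ^ N' * M' ≤ 2 ^ N * M →
        (FAfam N' M' y = famFA N M ∨ FAfam N' M' y = famFB N M ∨ FAfam N' M' y = famFC N M ∨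
          FAfam N' M' y = famG N M ∨ FAfam N' M' y = famG' N M) →
        ∀ (P : Pos) (q v : ℕ), q.Prime → q ≠ 2 → 1 ≤ v →
        (cellMass (FAfam N' M' y) P q v ≤ max A₁ A₂ * (Real.log (x : ℝ) ^ 24 * (((q : ℝ) ^ v)⁻¹) ^ (7 / 12 : ℝ) +
            ((x : ℝ))⁻¹ ^ (2 / 5 : ℝ))) ∧ (((x : ℕ) : ℝ) < (q : ℝ) ^ v → cellMass (FAfam N' M' y) P q v = 0) := by
      intro N' M' hMM' hX' hmem P q v hq hq2 hv
      have h := hFA N' M' hMM' hX' (hsz _ hmem) P q v hq hq2 hv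
      exact ⟨mono₁ (hB0 q v) h.1, h.2⟩
    intro F hF P q v hq hq2 hv
    rcases hF with rfl | rfl | rfl | rfl | rfl
    · exact hA' N M le_rfl le_rfl (Or.inl (by rw [famFA, hyl])) P q v hq hq2 hv |> fun h => by rwa [famFA, hyl]
    · -- `FB` is the swap of `FA`
      have h := hA' N M le_rfl le_rfl (Or.inl (by rw [famFA, hyl]))
      rw [famFB, hyl]
      cases P with
      | A => rw [cellMass_FBfam_A]; exact h Pos.B q v hq hq2 hv
      | B => rw [cellMass_FBfam_B]; exact h Pos.A q v hq hq2 hv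
      | C => rw [cellMass_FBfam_C]; exact h Pos.C q v hq hq2 hv
    · have h := hFC (hsz _ (Or.inr (Or.inr (Or.inl (by rw [famFC, hyl]))))) P q v hq hq2 hv
      rw [famFC, hyl]
      exact ⟨mono₂ (hB0 q v) h.1, h.2⟩
    · exact hA' 1 (2 ^ (N - 1) * M) hMle hN1.le (Or.inr (Or.inr (Or.inr (Or.inl (by rw [famG, hyl]))))) P q v hq
        hq2 hv |> fun h => by rwa [famG, hyl]
    · exact hA' 1 M le_rfl hN2 (Or.inr (Or.inr (Or.inr (Or.inr (by rw [famG', hyl]))))) P q v hq hq2 hv |>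
        fun h => by rwa [famG', hyl]
  -- friability: no cells above `y`
  have hy2' : 2 ≤ levelOf N M := by rw [hyl]; exact hy2
  have hfri : ∀ F : Finset (ℕ × ℕ × ℕ),
      (F = famFA N M ∨ F = famFB N M ∨ F = famFC N M ∨ F = famG N M ∨ F = famG' N M) →
      ∀ (P : Pos) (q v : ℕ), levelOf N M < q → cellMass F P q v = 0 := by
    intro F hF P q v hq
    have hA : ∀ {N' M' : ℕ}, ∀ (P : Pos) (v : ℕ), cellMass (FAfam N' M' (levelOf N M)) P q v = 0 := fun P v =>
      CellLawsBook.cellMass_eq_zero_of_lt (fun T hT => (FAfam_spec hy2' hT).1.1)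
        (friableMembers_of_smooth fun T hT => (FAfam_spec hy2' hT).2.2.2.2) hq P v
    rcases hF with rfl | rfl | rfl | rfl | rfl
    · exact hA P v
    · exact CellLawsBook.cellMass_eq_zero_of_lt (fun T hT => (FBfam_spec hy2' hT).1.1)
        (friableMembers_of_smooth fun T hT => (FBfam_spec hy2' hT).2.2.2) hq P v
    · exact CellLawsBook.cellMass_eq_zero_of_lt (fun T hT => (FCfam_spec hy2' hT).1.1)
        (friableMembers_of_smooth fun T hT => (FCfam_spec hy2' hT).2.2.2) hq P v
    · exact hA P v
    · exact hA P v
  -- summation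
  have key : ∀ F : Finset (ℕ × ℕ × ℕ),
      (F = famFA N M ∨ F = famFB N M ∨ F = famFC N M ∨ F = famG N M ∨ F = famG' N M) →
      TailSmall e (shallowOf N M) F := by
    intro F hF P Q V
    have h := hsum (fun q v => cellMass F P q v) (fun q v => CellLawsBook.cellMass_nonneg F P q v)
      (fun q v _ hyq => hfri F hF P q v (by rwa [hyl]))
      (fun q v hq hq3 hv _ => (hcell F hF P q v hq (by omega) hv).1)
      (fun q v hq hq3 hv hlt => (hcell F hF P q v hq (by omega) hv).2 hlt) (oddPrimesBelow Q)
      (fun q hq => ⟨(Finset.mem_filter.1 hq).2.1, TiltBook.three_le_of_mem_oddPrimesBelow hq⟩) V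
    rw [shallowOf, hyl]
    simp only [TiltBook.keyWeight_exps]
    exact h
  exact ⟨key _ (Or.inl rfl), key _ (Or.inr (Or.inl rfl)), key _ (Or.inr (Or.inr (Or.inl rfl))),
    key _ (Or.inr (Or.inr (Or.inr (Or.inl rfl)))), key _ (Or.inr (Or.inr (Or.inr (Or.inr rfl))))⟩

end Summit.ABC.ABC.Theorems.TameLocalReceptacle

end
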